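import Summits.Langlands.Langlands.Theses.SkinnerWilesDefectOne
import Literature.NumberTheory.Automorphic.AutomorphicRepCentralCharacter

/-!
# `ProModularOrdinaryClassical` (stmt-Langlands-12921) — Negative knowledge V: the determinant
# shadow of the conclusion

From the standing disprover's `Cruxes/ProModularOrdinaryClassical/Disproof.lean` (cdisprove gen 2,
cycle 2, §1f). A formal NECESSARY CONDITION for the crux's conclusion
`∃ π cuspidal, ∀ᶠ v, SatakeFrobCompatibleAt ι π ρ v`, with no input beyond the tree's Borel–Jacquet
central character (`AutomorphicRepData.exists_heckeCharacter_valueAtUniformizer_eq_prod`):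

* `det_frob_eq_of_satakeFrobCompatibleAt` — Satake–Frobenius compatibility at `v` pins the
  determinant of every arithmetic Frobenius at `v`: `ι(det ρ(σ)) = ∏_{a ∈ α} a⁻¹` for the Satake
  parameter `α` of `π` at `v` (constant term of `arithFrobPolyOfSatake ι q_v 1 α`);
* `exists_heckeCharacter_of_satakeConclusion` — hence, if the conclusion holds for `(ι, ρ)`, there is
  a (continuous, by definition) Hecke character `Ω` of `F`, unramified at almost all `v`, with
  `Ω(ϖ_v) · ι(det ρ(Frob_v)) = 1` at almost all `v`: **`ι ∘ (det ρ)⁻¹` is the Satake shadow of a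
  Hecke character.**

Use (Disproof §1f): this is the door through which the ONE-PLACE-ordinarity variant of the crux and
the exponent-zero variant are killed on paper — twisting a classical `ρ₀` by a `p`-adic character of
`Γ_F` infinitely and non-algebraically ramified at one place above `p` keeps pro-modularity and
(partial) ordinarity but makes `ι ∘ det ρ ∘ Art` discontinuous on principal-idele-dense sets, so no
`Ω` exists; in the crux itself ordinarity at EVERY `v ∣ p` makes `det ρ` locally algebraic and the
door is shut. [folklore]
-/

set_option linter.dupNamespace false

namespace Summit.Langlands.Langlands.Theorems.ProModularOrdinaryClassical.Negative

open scoped MatrixGroups Matrix Classical NumberField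
open Literature.NumberTheory.Automorphic Literature.NumberTheory.GaloisRepresentations
open NumberField IsDedekindDomain Filter Polynomial

variable {F : Type} [Field F] [NumberField F] {p : ℕ} [Fact p.Prime]

/-- Constant term of the predicted Frobenius polynomial: `(∏_{a∈α} (X − c_a)).coeff 0 = (−1)^{|α|} ∏ c_a`
with `c_a = ι⁻¹((q^{(m-1)/2} a)⁻¹)`. [folklore] -/
theorem coeff_zero_arithFrobPolyOfSatake (ι : PadicAlgCl p ≃+* ℂ) (q m : ℕ) (α : Multiset ℂ) :
    (arithFrobPolyOfSatake ι q m α).coeff 0 =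
      (-1) ^ Multiset.card α *
        (α.map fun a => ι.symm ((((Real.sqrt q : ℝ) : ℂ) ^ (m - 1) * a)⁻¹)).prod := by
  rw [arithFrobPolyOfSatake, coeff_zero_eq_eval_zero, eval_multiset_prod, Multiset.map_map]
  have e : (α.map ((fun f : (PadicAlgCl p)[X] => eval 0 f) ∘ fun a =>
      X - C (ι.symm ((((Real.sqrt q : ℝ) : ℂ) ^ (m - 1) * a)⁻¹)))) =
      (α.map fun a => ι.symm ((((Real.sqrt q : ℝ) : ℂ) ^ (m - 1) * a)⁻¹)).map Neg.neg := by
    rw [Multiset.map_map]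
    refine Multiset.map_congr rfl fun a _ => ?_
    simp
  rw [e, Multiset.prod_map_neg, Multiset.card_map]

/-- **Satake–Frobenius compatibility pins the determinant of Frobenius.** If `π` (any Borel–Jacquet
automorphic representation datum on `GL₂(𝔸_F)`) and `ρ : Γ_F → GL₂(ℚ̄_p)` are Satake–Frobenius
compatible at `v` through `ι`, with Satake parameter `α`, then every arithmetic Frobenius `σ` at `v` has
`ι(det ρ(σ)) = ∏_{a ∈ α} a⁻¹`. [folklore] -/
theorem det_frob_eq_of_satakeFrobCompatibleAt {hcpt : isCompact_glFiniteIntegralLevel 2 F}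
    (ι : PadicAlgCl p ≃+* ℂ) {π : AutomorphicRepData (AutomorphyDatum.gl 2 F hcpt)}
    {ρ : FramedGaloisRep F (PadicAlgCl p) 2} {v : HeightOneSpectrum (𝓞 F)}
    (h : Summit.Langlands.SatakeFrobCompatibleAt ι π ρ v) :
    ∃ α : Multiset ℂ, π.HasSatakeParamAt v α ∧
      ∀ 𝔓 ∈ v.primesAbove, ∀ σ : Field.absoluteGaloisGroup F, IsArithFrobAt (𝓞 F) σ 𝔓 →
        ι (ρ σ).val.det = (α.map fun a => a⁻¹).prod := by
  obtain ⟨α, hα, -, hch⟩ := h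
  refine ⟨α, hα, fun 𝔓 h𝔓 σ hσ => ?_⟩
  have hP : (ρ σ).val.charpoly = arithFrobPolyOfSatake ι v.residueCard 1 α := hch 𝔓 h𝔓 σ hσ
  have hcard : Multiset.card α = 2 := by
    have h1 := congrArg natDegree hP
    rw [Matrix.charpoly_natDegree_eq_dim, Fintype.card_fin, natDegree_arithFrobPolyOfSatake] at h1
    exact h1.symm
  have hdet : (ρ σ).val.det = (α.map fun a => ι.symm a⁻¹).prod := by
    rw [Matrix.det_eq_sign_charpoly_coeff, hP, coeff_zero_arithFrobPolyOfSatake, hcard,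
      Fintype.card_fin]
    simp
  rw [hdet, map_multiset_prod, Multiset.map_map]
  refine congrArg Multiset.prod (Multiset.map_congr rfl fun a _ => ?_)
  simp

/-- **The determinant shadow of the crux's conclusion.** If some cuspidal `π` on `GL₂(𝔸_F)` is
Satake–Frobenius compatible with `ρ` through `ι` at almost all places, then there is a Hecke character
`Ω : 𝕀_F →ₜ* ℂˣ` (continuous and trivial on `F^×` BY DEFINITION) which is unramified at almost all
`v` and satisfies `Ω(ϖ_v) · ι(det ρ(σ)) = 1` for almost all `v` and every arithmetic Frobenius `σ` at
`v`: `ι ∘ (det ρ)⁻¹` is the Satake shadow of a Hecke character (`Ω = ω_π`, Borel–Jacquet).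
L-algebraicity of `π` is not needed. [folklore] -/
theorem exists_heckeCharacter_of_satakeConclusion {hcpt : isCompact_glFiniteIntegralLevel 2 F}
    (ι : PadicAlgCl p ≃+* ℂ) (ρ : FramedGaloisRep F (PadicAlgCl p) 2)
    (h : ∃ π : CuspidalAutomorphicRepData 2 F hcpt,
      ∀ᶠ v in cofinite, Summit.Langlands.SatakeFrobCompatibleAt ι π.1 ρ v) :
    ∃ Ω : HeckeCharacter F, ∀ᶠ v : HeightOneSpectrum (𝓞 F) in cofinite,
      Ω.IsUnramifiedAt v ∧
        ∀ 𝔓 ∈ v.primesAbove, ∀ σ : Field.absoluteGaloisGroup F, IsArithFrobAt (𝓞 F) σ 𝔓 →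
          (Ω.valueAtUniformizer v : ℂ) * ι (ρ σ).val.det = 1 := by
  obtain ⟨π, hπ⟩ := h
  obtain ⟨Ω, hΩ⟩ := π.1.exists_heckeCharacter_valueAtUniformizer_eq_prod
  refine ⟨Ω, hπ.mono fun v hv => ?_⟩
  obtain ⟨α, hα, hdet⟩ := det_frob_eq_of_satakeFrobCompatibleAt ι hv
  obtain ⟨hur, hval⟩ := hΩ v α hα
  refine ⟨hur, fun 𝔓 h𝔓 σ hσ => ?_⟩
  have hne : ι (ρ σ).val.det ≠ 0 := by
    rw [map_ne_zero_iff _ ι.injective, ← Matrix.GeneralLinearGroup.val_det_apply]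
    exact Units.ne_zero _
  rw [hdet 𝔓 h𝔓 σ hσ, Multiset.prod_map_inv'] at hne ⊢
  rw [hval]
  exact mul_inv_cancel₀ fun h0 => hne (inv_eq_zero.2 h0)
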